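import Mathlib.Data.List.Rotate
import Mathlib.Data.List.Range
import Mathlib.Data.List.Permutation
import Mathlib.Data.Nat.Basic
import HarnessLib

/-!
# Brown's dinner-party configurations (convergent cellular configurations on `M_{0,n}`)

Topic `Literature/NumberTheory/Irrationality/Brown2016`. The combinatorial core of F. Brown,
*Irrationality proofs for zeta values, moduli spaces and dinner parties*, Mosc. J. Comb. Number
Theory **6** (2016) 102–165 = arXiv:1412.6508 [Brown2016]: the seating plans `σ ∈ S_n` whose basic
cellular integral `I_σ(N) = ∫_{S_n} f_σ^N ω_σ` on the moduli space `M_{0,n}` CONVERGES, and their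
classes ("configurations") modulo the two dihedral symmetry groups. In Brown's words
[Brown2016, §1.5]: "Call a permutation `σ` convergent if no set of `k` elements in `{1,…,n}` are
simultaneously consecutive for `δ⁰` and `σδ⁰`, for all `2 ≤ k ≤ n−2`", equivalently [§3.1] "no set of
`k` consecutive elements (where the indices are taken modulo `n`) `{σ_i, σ_{i+1}, …}` is itself a set
of consecutive integers modulo `n`, for all `2 ≤ k ≤ n−2`"; "the basic cellular integral … converges
if and only if `σ` is a convergent permutation" [§1.5; Lemma 3.6]; two permutations are equivalent
when they differ by the dihedral symmetries `D_{2n}` of the source `n`-gon (cyclic rotation and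
reversal of the positions) and of the target (`σ_i ↦ σ_i + 1`, `σ_i ↦ −σ_i` modulo `n`)
[§3.1, displays (3.4)–(3.5)], "and we call the equivalence class a configuration" [§1.5].

HONEST FRAMING (cell pub-zeta5): systematic search; no irrationality claim unless certified. This
file contains no statement about zeta values; it certifies the finite combinatorics that indexes the
search space of cellular integrals.

## Contents (all definitions are computable; all theorems are kernel-decided, no named facts)

* `Brown2016.window`, `Brown2016.isCyclicBlock`, `Brown2016.isConvergent` (Bool) and the `Prop`
  `Brown2016.IsConvergent n σ` for a seating plan written, as in the source, as the list
  `(σ(1), …, σ(n))` of the integers `1, …, n` (internally reduced modulo `n`);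
* `Brown2016.act`, `Brown2016.equiv` / `Brown2016.Equivalent n σ τ`: the `D_{2n} × D_{2n}` action and
  the induced equivalence ("same configuration");
* the printed lists of convergent configurations [Brown2016, Appendix 2, §10.1]:
  `reps5 = [[5,2,4,1,3]]`, `reps6 = [[6,2,4,1,5,3]]`, `reps7` (five), `reps8` (seventeen, Brown's
  `₈π₁,…,₈π₁₀` and duals, in his numbering), and the theorems
  - `isConvergent_repsN` (`N = 5,…,8`): every listed permutation is convergent;
  - `pairwise_not_equivalent_repsN` (`N = 7, 8`): the listed permutations are pairwise inequivalent;
  - `complete_repsN` (`N = 5, 6, 7`): every convergent permutation of `1..N` is equivalent to a listed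
    one — together: "`𝒞_5 = 1`, `𝒞_6 = 1`, `𝒞_7 = 5`" of the printed table
    `𝒞_N = 0, 1, 1, 5, 17, 105, 771, 7028` (`N = 4,…,11`) [Brown2016, App. 2 §10.1], and `𝒞_4 = 0`
    (`no_convergent_four`);
  - Brown's example [§1.5]: `(2,4,1,3,6,8,5,7)` solves the classical dinner-table problem (no block of
    size `2`) but is not convergent (the block `{2,4,1,3}`), `example_classical_not_convergent`.
  For `N = 8` completeness (hence `𝒞_8 = 17`) is NOT kernel-checked here (40320 seatings exceed a
  reasonable `decide` budget); it is reproduced by the cell's independent enumerator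
  `code/calibration/brown2016_configurations.py` (which also re-derives `𝒞_9 = 105`), and is recorded
  in this docstring only.

## Deliberately NOT here
The forms `f_σ, ω_σ`, the integrals `I_σ(N)` and their MZV evaluations (Brown's Thm 1.1, Cor. 8.2,
App. 2 §10.2 tables) — periods of `M_{0,n}` are not available in Mathlib; duality `(δ,δ')^∨ = (δ',δ)`
(Def. 3.2) is not needed for the counts and is omitted.
-/

namespace Literature.NumberTheory.Irrationality.Brown2016

/-! ### Convergent seating plans -/

/-- The cyclic window of `σ` of size `k` starting at position `i`: the entries
`σ_i, σ_{i+1}, …, σ_{i+k−1}`, indices modulo the length. [cite: Brown2016, §3.1] -/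
def window (σ : List ℕ) (i k : ℕ) : List ℕ :=
  (List.range k).map fun j => σ.getD ((i + j) % σ.length) 0

/-- `S` (a list of residues) is, as a set modulo `n`, a block of `|S|` consecutive integers modulo `n`:
`{S mod n} = {a, a+1, …, a+|S|−1 mod n}` for some `a`. [cite: Brown2016, §3.1] -/
def isCyclicBlock (n : ℕ) (S : List ℕ) : Bool :=
  (List.range n).any fun a =>
    ((List.range S.length).all fun j => (S.map (· % n)).contains ((a + j) % n)) &&
      (S.all fun x => ((List.range S.length).map fun j => (a + j) % n).contains (x % n))

/-- Brown's convergence condition for a seating plan `σ = (σ_1,…,σ_n)` (a list of the integers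
`1,…,n`, read modulo `n`): no cyclic window of size `k`, `2 ≤ k ≤ n − 2`, is a block of consecutive
integers modulo `n`. (Boolean form.) [cite: Brown2016, §1.5 and §3.1] -/
def isConvergent (n : ℕ) (σ : List ℕ) : Bool :=
  (List.range (n - 3)).all fun k' =>
    (List.range n).all fun i => !isCyclicBlock n (window σ i (k' + 2))

/-- `σ` is a **convergent permutation** ("the basic cellular integral `I_σ(N)` converges if and only if
`σ` is a convergent permutation"). [cite: Brown2016, §1.5; Lemma 3.6] -/
def IsConvergent (n : ℕ) (σ : List ℕ) : Prop :=
  isConvergent n σ = true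

/-- `IsConvergent n σ` is decidable (it is a Boolean equation). [folklore] -/
instance instDecidableIsConvergent (n : ℕ) (σ : List ℕ) : Decidable (IsConvergent n σ) := by
  unfold IsConvergent; infer_instance

/-- `σ` is a seating plan of `n` guests: a rearrangement of `1, …, n`. [cite: Brown2016, §1.5] -/
def IsSeating (n : ℕ) (σ : List ℕ) : Prop :=
  σ.Perm (List.range' 1 n)

/-! ### The two dihedral symmetries and configurations -/

/-- The action of `D_{2n} × D_{2n}` on seating plans (values reduced modulo `n`): optionally reverse the
positions, rotate the positions by `r`, optionally negate the values, shift the values by `c`.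
[cite: Brown2016, §3.1 (the double cosets `D_{2n} \ Bij / D_{2n}`)] -/
def act (n : ℕ) (posRev : Bool) (r : ℕ) (valNeg : Bool) (c : ℕ) (σ : List ℕ) : List ℕ :=
  ((if posRev then σ.reverse else σ).rotate r).map fun x =>
    ((if valNeg then n - x % n else x % n) + c) % n

/-- `σ` and `τ` define the same configuration: `τ mod n` is in the `D_{2n} × D_{2n}`-orbit of `σ`.
(Boolean form.) [cite: Brown2016, §1.5 ("we call the equivalence class a configuration"); Def. 3.1] -/
def equiv (n : ℕ) (σ τ : List ℕ) : Bool :=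
  [false, true].any fun pr => (List.range n).any fun r => [false, true].any fun vn =>
    (List.range n).any fun c => act n pr r vn c σ == τ.map (· % n)

/-- `σ` and `τ` are **equivalent** (same configuration). [cite: Brown2016, Definition 3.1] -/
def Equivalent (n : ℕ) (σ τ : List ℕ) : Prop :=
  equiv n σ τ = true

/-- `Equivalent n σ τ` is decidable (it is a Boolean equation). [folklore] -/
instance instDecidableEquivalent (n : ℕ) (σ τ : List ℕ) : Decidable (Equivalent n σ τ) := by
  unfold Equivalent; infer_instance

/-! ### The printed lists of convergent configurations (Appendix 2, §10.1) -/

/-- `N = 5`: "There is a unique convergent configuration: `₅π = ₅π^∨ = [5,2,4,1,3]`".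
[cite: Brown2016, App. 2 §10.1.1] -/
def reps5 : List (List ℕ) := [[5, 2, 4, 1, 3]]

/-- `N = 6`: "There is a unique convergent configuration: `₆π = ₆π^∨ = [6,2,4,1,5,3]`".
[cite: Brown2016, App. 2 §10.1.2] -/
def reps6 : List (List ℕ) := [[6, 2, 4, 1, 5, 3]]

/-- `N = 7`: "There are five convergent configurations": `₇π₁ = [7,2,4,1,6,3,5]`,
`₇π₁^∨ = [7,2,5,1,4,6,3]`, `₇π₂ = [7,2,4,6,1,3,5]`, `₇π₂^∨ = [7,3,6,2,5,1,4]`,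
`₇π₃ = ₇π₃^∨ = [7,2,5,1,3,6,4]`. [cite: Brown2016, App. 2 §10.1.3] -/
def reps7 : List (List ℕ) :=
  [[7, 2, 4, 1, 6, 3, 5], [7, 2, 5, 1, 4, 6, 3], [7, 2, 4, 6, 1, 3, 5], [7, 3, 6, 2, 5, 1, 4],
    [7, 2, 5, 1, 3, 6, 4]]

/-- `N = 8`: "There are 17 convergent configurations, comprising 7 pairs of configurations and their
duals … and three self-dual configurations", in Brown's order
`₈π₁, ₈π₁^∨, ₈π₄, ₈π₄^∨, ₈π₅, ₈π₅^∨, ₈π₇, ₈π₇^∨, ₈π₈, ₈π₈^∨, ₈π₉, ₈π₉^∨, ₈π₁₀, ₈π₁₀^∨, ₈π₂, ₈π₃, ₈π₆`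
(`₈π₈ = ⁸π_odd` is the Ball–Rivoal configuration giving forms in `1, ζ(3), ζ(5)`; `₈π₈^∨` is the
Brown–Zudilin family). [cite: Brown2016, App. 2 §10.1.4] -/
def reps8 : List (List ℕ) :=
  [[8, 2, 4, 1, 5, 7, 3, 6], [8, 2, 5, 1, 7, 4, 6, 3],
    [8, 2, 4, 7, 1, 6, 3, 5], [8, 2, 4, 7, 3, 6, 1, 5],
    [8, 2, 5, 3, 7, 1, 6, 4], [8, 2, 6, 1, 5, 3, 7, 4],
    [8, 2, 4, 6, 1, 3, 7, 5], [8, 2, 5, 1, 6, 3, 7, 4],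
    [8, 2, 5, 1, 6, 4, 7, 3], [8, 2, 4, 1, 7, 5, 3, 6],
    [8, 2, 5, 7, 3, 1, 6, 4], [8, 3, 6, 1, 5, 2, 7, 4],
    [8, 2, 5, 7, 3, 6, 1, 4], [8, 2, 5, 7, 4, 1, 6, 3],
    [8, 2, 4, 1, 6, 3, 7, 5], [8, 2, 5, 1, 7, 3, 6, 4], [8, 3, 6, 1, 4, 7, 2, 5]]

/-! ### Kernel-checked statements -/

/-- Brown's example: `σ = (2,4,1,3,6,8,5,7)` "is a solution to the classical dinner table problem but
fails our condition for `k = 4`" — no window of size `2` is a block, but `σ` is not convergent.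
[cite: Brown2016, §1.5] -/
theorem example_classical_not_convergent :
    ((List.range 8).all fun i => !isCyclicBlock 8 (window [2, 4, 1, 3, 6, 8, 5, 7] i 2)) = true ∧
      ¬ IsConvergent 8 [2, 4, 1, 3, 6, 8, 5, 7] := by
  decide +kernel

/-- `𝒞_4 = 0`: no seating plan of `4` guests is convergent. [cite: Brown2016, App. 2 §10.1 (table)] -/
theorem no_convergent_four : ∀ σ, IsSeating 4 σ → ¬ IsConvergent 4 σ := by
  have h : ∀ σ ∈ (List.range' 1 4).permutations', ¬ IsConvergent 4 σ := by decide +kernel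
  exact fun σ hσ => h σ (List.mem_permutations'.2 hσ)

/-- Every listed `N = 5` plan is convergent. [cite: Brown2016, App. 2 §10.1.1] -/
theorem isConvergent_reps5 : ∀ σ ∈ reps5, IsConvergent 5 σ := by decide +kernel

/-- Every listed `N = 6` plan is convergent. [cite: Brown2016, App. 2 §10.1.2] -/
theorem isConvergent_reps6 : ∀ σ ∈ reps6, IsConvergent 6 σ := by decide +kernel

/-- Every listed `N = 7` plan is convergent. [cite: Brown2016, App. 2 §10.1.3] -/
theorem isConvergent_reps7 : ∀ σ ∈ reps7, IsConvergent 7 σ := by decide +kernel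

/-- Every listed `N = 8` plan is convergent. [cite: Brown2016, App. 2 §10.1.4] -/
theorem isConvergent_reps8 : ∀ σ ∈ reps8, IsConvergent 8 σ := by decide +kernel

/-- `𝒞_5 = 1` (completeness): every convergent seating plan of `5` guests is equivalent to
`[5,2,4,1,3]`. [cite: Brown2016, App. 2 §10.1.1] -/
theorem complete_reps5 :
    ∀ σ, IsSeating 5 σ → IsConvergent 5 σ → ∃ τ ∈ reps5, Equivalent 5 σ τ := by
  have h : ∀ σ ∈ (List.range' 1 5).permutations', IsConvergent 5 σ → ∃ τ ∈ reps5, Equivalent 5 σ τ := by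
    decide +kernel
  exact fun σ hσ => h σ (List.mem_permutations'.2 hσ)

/-- `𝒞_6 = 1` (completeness): every convergent seating plan of `6` guests is equivalent to
`[6,2,4,1,5,3]`. [cite: Brown2016, App. 2 §10.1.2] -/
theorem complete_reps6 :
    ∀ σ, IsSeating 6 σ → IsConvergent 6 σ → ∃ τ ∈ reps6, Equivalent 6 σ τ := by
  have h : ∀ σ ∈ (List.range' 1 6).permutations', IsConvergent 6 σ → ∃ τ ∈ reps6, Equivalent 6 σ τ := by
    decide +kernel
  exact fun σ hσ => h σ (List.mem_permutations'.2 hσ)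

/-- Boolean completeness check for `N = 7` restricted to the plans with first guest `x`:
every convergent `x :: rest`, `rest` a rearrangement of `{1,…,7} ∖ {x}`, is equivalent to a listed plan.
(Chunking device for the kernel computation; no mathematical content.) [folklore] -/
def completeChunk7 (x : ℕ) : Bool :=
  (((List.range' 1 7).erase x).permutations').all fun rest =>
    !isConvergent 7 (x :: rest) || reps7.any (equiv 7 (x :: rest))

-- finite enumeration of 720 seating plans by kernel evaluation: needs a larger heartbeat budget
set_option maxHeartbeats 1600000 in
/-- Chunk `x = 1` of the `N = 7` completeness computation. [folklore] -/
theorem completeChunk7_one : completeChunk7 1 = true := by decide +kernel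

-- finite enumeration of 720 seating plans by kernel evaluation: needs a larger heartbeat budget
set_option maxHeartbeats 1600000 in
/-- Chunk `x = 2` of the `N = 7` completeness computation. [folklore] -/
theorem completeChunk7_two : completeChunk7 2 = true := by decide +kernel

-- finite enumeration of 720 seating plans by kernel evaluation: needs a larger heartbeat budget
set_option maxHeartbeats 1600000 in
/-- Chunk `x = 3` of the `N = 7` completeness computation. [folklore] -/
theorem completeChunk7_three : completeChunk7 3 = true := by decide +kernel

-- finite enumeration of 720 seating plans by kernel evaluation: needs a larger heartbeat budget
set_option maxHeartbeats 1600000 in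
/-- Chunk `x = 4` of the `N = 7` completeness computation. [folklore] -/
theorem completeChunk7_four : completeChunk7 4 = true := by decide +kernel

-- finite enumeration of 720 seating plans by kernel evaluation: needs a larger heartbeat budget
set_option maxHeartbeats 1600000 in
/-- Chunk `x = 5` of the `N = 7` completeness computation. [folklore] -/
theorem completeChunk7_five : completeChunk7 5 = true := by decide +kernel

-- finite enumeration of 720 seating plans by kernel evaluation: needs a larger heartbeat budget
set_option maxHeartbeats 1600000 in
/-- Chunk `x = 6` of the `N = 7` completeness computation. [folklore] -/
theorem completeChunk7_six : completeChunk7 6 = true := by decide +kernel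

-- finite enumeration of 720 seating plans by kernel evaluation: needs a larger heartbeat budget
set_option maxHeartbeats 1600000 in
/-- Chunk `x = 7` of the `N = 7` completeness computation. [folklore] -/
theorem completeChunk7_seven : completeChunk7 7 = true := by decide +kernel

/-- `𝒞_7 = 5` (completeness): every convergent seating plan of `7` guests is equivalent to one of the
five listed plans. [cite: Brown2016, App. 2 §10.1.3] -/
theorem complete_reps7 :
    ∀ σ, IsSeating 7 σ → IsConvergent 7 σ → ∃ τ ∈ reps7, Equivalent 7 σ τ := by
  intro σ hσ hc
  -- split off the first guest
  obtain ⟨x, rest, rfl⟩ : ∃ x rest, σ = x :: rest := by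
    cases σ with
    | nil => exact absurd hσ.length_eq (by decide)
    | cons x rest => exact ⟨x, rest, rfl⟩
  have hx : x ∈ List.range' 1 7 := hσ.subset List.mem_cons_self
  have hrest : rest ∈ ((List.range' 1 7).erase x).permutations' :=
    List.mem_permutations'.2 ((hσ.trans (List.perm_cons_erase hx)).cons_inv)
  -- the chunk containing `σ`
  have hchunk : completeChunk7 x = true := by
    have e : List.range' 1 7 = [1, 2, 3, 4, 5, 6, 7] := rfl
    rw [e] at hx
    simp only [List.mem_cons, List.not_mem_nil, or_false] at hx
    rcases hx with rfl | rfl | rfl | rfl | rfl | rfl | rfl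
    exacts [completeChunk7_one, completeChunk7_two, completeChunk7_three, completeChunk7_four,
      completeChunk7_five, completeChunk7_six, completeChunk7_seven]
  unfold completeChunk7 at hchunk
  rw [List.all_eq_true] at hchunk
  have h := hchunk rest hrest
  rw [Bool.or_eq_true, Bool.not_eq_true', List.any_eq_true] at h
  rcases h with h | ⟨τ, hτ, hστ⟩
  · exact absurd hc (by simp [IsConvergent, h])
  · exact ⟨τ, hτ, hστ⟩

/-- The five listed `N = 7` plans are pairwise inequivalent. [cite: Brown2016, App. 2 §10.1.3] -/
theorem pairwise_not_equivalent_reps7 : reps7.Pairwise fun σ τ => ¬ Equivalent 7 σ τ := by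
  decide +kernel

/-- The seventeen listed `N = 8` plans are pairwise inequivalent. [cite: Brown2016, App. 2 §10.1.4] -/
theorem pairwise_not_equivalent_reps8 : reps8.Pairwise fun σ τ => ¬ Equivalent 8 σ τ := by
  decide +kernel

end Literature.NumberTheory.Irrationality.Brown2016
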